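import Mathlib
import HarnessLib
import Summits.NavierStokesRegularity.NavierStokesRegularity.Theorems.CompletionRelayChainPhaseITaylorModel

/-!
# Route `CompletionRelayChain` — crux `RelayFrontStep` (stmt-NavierStokesRegularity-24850), K-side of `stub_phaseI`,
  work package K2(c)-i: the EXTRA TAYLOR-MODEL OPERATIONS of the self-integrating Phase-I checker

On top of K1 (`…PhaseITaylorModel`, p617189: `TM q`, `add/smul/mul`, `rangeLo/rangeHi`, soundness) the checker needs:
* `memo` — materialise the coefficient closures into vectors (`memo p = p`; evaluation cost only);
* `rnd/rndUp/round` — outward rounding of all coefficients to the dyadic grid `2^{-P}` with the rounding error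
  booked into the remainder (`contains_round`);
* `sq` — the truncated SQUARE with the remainder cross term `e·(2p+e)` re-centred (`e² ∈ [0,ρ²]` contributes centre
  `ρ²/2`, radius `ρ²/2`): squares of wide remainder balls keep their sign (`contains_sq`);
* `sclI` — multiplication by a real scalar known to lie in `[lo,hi]` (the irrational rates `Λ_k = 2^{5k/2}`) (`contains_sclI`);
* `divNat`, `addRem`, `const` with their soundness, and the ONE-SIDED range bounds `lo2 ≤ x ≤ hi2` (pure squares
  `Q_{ii}θᵢ²` contribute `[min(Q_{ii},0), max(Q_{ii},0)]`, not `±|Q_{ii}|`).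
Pure algebra (folklore Taylor-model arithmetic, Berz–Makino); MODEL-lattice bookkeeping (rung TL-M3-R64) — nothing here
is a statement about the Navier–Stokes equations.
-/

set_option linter.dupNamespace false

namespace Summit.NavierStokesRegularity.NavierStokesRegularity.Cruxes.RelayFrontStep.PhaseI

open scoped BigOperators
open Finset

namespace TM

variable {q : ℕ}

/-! ### Materialisation -/

/-- Materialise the coefficient functions into vectors (same Taylor model, O(1) coefficient access). [folklore] -/
def memo (p : TM q) : TM q :=
  let L : Vector ℚ q := Vector.ofFn p.lin
  let Qd : Vector (Vector ℚ q) q := Vector.ofFn fun i => Vector.ofFn (p.quad i)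
  ⟨p.c0, fun i => L[i], fun i j => (Qd[i])[j], p.rem⟩

/-- `memo p = p`. [folklore] -/
@[simp] theorem memo_eq (p : TM q) : memo p = p := by
  obtain ⟨c0, lin, quad, rem⟩ := p
  simp [memo, Fin.getElem_fin, Vector.getElem_ofFn]

/-! ### Constants, remainder inflation -/

/-- The constant Taylor model `c ± r`. [folklore] -/
def const (c r : ℚ) : TM q := ⟨c, fun _ => 0, fun _ _ => 0, r⟩

/-- `const c r` evaluates to `c`. [folklore] -/
theorem evalR_const (c r : ℚ) (θ : Fin q → ℝ) : (const c r : TM q).evalR θ = c := by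
  simp [evalR, const]

/-- `const c r` contains every `x` with `|x - c| ≤ r`. [folklore] -/
theorem contains_const {c r : ℚ} {θ : Fin q → ℝ} {x : ℝ} (hx : |x - c| ≤ r) : (const c r : TM q).Contains θ x := by
  unfold Contains; rw [evalR_const]; exact hx

/-- Inflate the remainder by `e`. [folklore] -/
def addRem (p : TM q) (e : ℚ) : TM q := ⟨p.c0, p.lin, p.quad, p.rem + e⟩

/-- `addRem p e` contains every `y` within `e` of a point contained in `p`. [folklore] -/
theorem contains_addRem {p : TM q} {θ : Fin q → ℝ} {x y : ℝ} {e : ℚ} (hx : p.Contains θ x) (hy : |y - x| ≤ e) :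
    (p.addRem e).Contains θ y := by
  unfold Contains at *
  have he : (p.addRem e).evalR θ = p.evalR θ := rfl
  have hr : ((p.addRem e).rem : ℝ) = p.rem + e := by simp [addRem]
  rw [he, hr]
  calc |y - p.evalR θ| = |(y - x) + (x - p.evalR θ)| := by ring_nf
    _ ≤ |y - x| + |x - p.evalR θ| := abs_add_le _ _
    _ ≤ e + p.rem := add_le_add hy hx
    _ = p.rem + e := add_comm _ _

/-- A contained point is within `|c0| + varAbs + rem` of zero. [folklore] -/
theorem abs_le_of_contains (p : TM q) {θ : Fin q → ℝ} (hθ : InBox θ) {x : ℝ} (hx : p.Contains θ x) :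
    |x| ≤ |(p.c0 : ℝ)| + p.varAbs + p.rem := by
  have h1 := p.abs_evalR_sub_c0_le hθ
  unfold Contains at hx
  have : x = (x - p.evalR θ) + (p.evalR θ - p.c0) + p.c0 := by ring
  rw [this]
  refine ((abs_add_le _ _).trans (add_le_add ((abs_add_le _ _).trans (add_le_add hx h1)) le_rfl)).trans ?_
  linarith

/-! ### Difference of two Taylor models -/

/-- Coefficient distance `|Δc₀| + Σ|Δℓ| + Σ_{i≤j}|ΔQ|` of two Taylor models. [folklore] -/
def dist1 (p r : TM q) : ℚ :=
  |p.c0 - r.c0| + (∑ i, |p.lin i - r.lin i|) + ∑ i, ∑ j, if i ≤ j then |p.quad i j - r.quad i j| else 0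

/-- `|p(θ) − r(θ)| ≤ dist1 p r` on the box. [folklore] -/
theorem abs_evalR_sub_evalR_le (p r : TM q) {θ : Fin q → ℝ} (hθ : InBox θ) :
    |p.evalR θ - r.evalR θ| ≤ (dist1 p r : ℝ) := by
  set d : TM q := p.add (r.smul (-1)) with hd
  have hev : d.evalR θ = p.evalR θ - r.evalR θ := by
    rw [hd, evalR_add, evalR_smul]; push_cast; ring
  have h1 := d.abs_evalR_sub_c0_le hθ
  have hdist : dist1 p r = |d.c0| + d.varAbs := by
    simp only [dist1, varAbs, linAbs, quadAbs, hd, add, smul, neg_one_mul, ← sub_eq_add_neg]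
    ring
  have hsplit : p.evalR θ - r.evalR θ = (d.evalR θ - d.c0) + d.c0 := by rw [hev]; ring
  rw [hsplit, hdist]
  push_cast
  refine (abs_add_le _ _).trans ?_
  linarith

/-! ### Outward rounding to the dyadic grid -/

/-- Round down to the grid `2^{-P}`. [folklore] -/
def rnd (P : ℕ) (x : ℚ) : ℚ := (⌊x * 2 ^ P⌋ : ℚ) / 2 ^ P

/-- Round up to the grid `2^{-P}`. [folklore] -/
def rndUp (P : ℕ) (x : ℚ) : ℚ := -rnd P (-x)

/-- `rnd P x ≤ x`. [folklore] -/
theorem rnd_le (P : ℕ) (x : ℚ) : rnd P x ≤ x := by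
  unfold rnd
  rw [div_le_iff₀ (by positivity)]
  exact Int.floor_le _

/-- `x ≤ rndUp P x`. [folklore] -/
theorem le_rndUp (P : ℕ) (x : ℚ) : x ≤ rndUp P x := by
  unfold rndUp; have := rnd_le P (-x); linarith

/-- Round every coefficient down to the grid (materialised; remainder unchanged). [folklore] -/
def trunc (P : ℕ) (p : TM q) : TM q :=
  let L : Vector ℚ q := Vector.ofFn fun i => rnd P (p.lin i)
  let Qd : Vector (Vector ℚ q) q := Vector.ofFn fun i => Vector.ofFn fun j => rnd P (p.quad i j)
  ⟨rnd P p.c0, fun i => L[i], fun i j => (Qd[i])[j], p.rem⟩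

/-- ROUND: coefficients rounded down to the grid, the coefficient distance booked into the remainder, which is
rounded up. [folklore] -/
def round (P : ℕ) (p : TM q) : TM q :=
  let p' := p.memo
  let t := p'.trunc P
  ⟨t.c0, t.lin, t.quad, rndUp P (p'.rem + dist1 p' t)⟩

/-- **Soundness of `round`.** [folklore] -/
theorem contains_round (P : ℕ) {p : TM q} {θ : Fin q → ℝ} (hθ : InBox θ) {x : ℝ} (hx : p.Contains θ x) :
    (p.round P).Contains θ x := by
  unfold Contains at *
  have hev : (p.round P).evalR θ = (p.trunc P).evalR θ := by
    simp only [round, memo_eq, evalR]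
  have hrem : ((p.round P).rem : ℝ) = ((rndUp P (p.rem + dist1 p (p.trunc P)) : ℚ) : ℝ) := by
    simp only [round, memo_eq]
  have hdiff := abs_evalR_sub_evalR_le p (p.trunc P) hθ
  have hup : ((p.rem + dist1 p (p.trunc P) : ℚ) : ℝ) ≤ ((rndUp P (p.rem + dist1 p (p.trunc P)) : ℚ) : ℝ) :=
    (Rat.cast_le (K := ℝ)).2 (le_rndUp P _)
  rw [hev, hrem]
  calc |x - (p.trunc P).evalR θ| = |(x - p.evalR θ) + (p.evalR θ - (p.trunc P).evalR θ)| := by ring_nf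
    _ ≤ |x - p.evalR θ| + |p.evalR θ - (p.trunc P).evalR θ| := abs_add_le _ _
    _ ≤ (p.rem : ℝ) + dist1 p (p.trunc P) := add_le_add hx hdiff
    _ ≤ _ := by push_cast at hup ⊢; exact hup

/-! ### Division by a natural number, scaling by an enclosed real -/

/-- Division by `n`. [folklore] -/
def divNat (n : ℕ) (p : TM q) : TM q := p.smul (1 / n)

/-- **Soundness of `divNat`.** [folklore] -/
theorem contains_divNat {n : ℕ} (hn : 0 < n) {p : TM q} {θ : Fin q → ℝ} {x : ℝ} (hx : p.Contains θ x) :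
    (p.divNat n).Contains θ (x / n) := by
  have h := contains_smul (1 / (n : ℚ)) hx
  have e : (((1 / (n : ℚ)) : ℚ) : ℝ) * x = x / n := by push_cast; field_simp
  rw [e] at h; exact h

/-- Multiplication by a real scalar `c ∈ [lo, hi]`: midpoint scaling, radius into the remainder. [folklore] -/
def sclI (lo hi : ℚ) (p : TM q) : TM q :=
  let m := (lo + hi) / 2
  let r := (hi - lo) / 2
  ⟨m * p.c0, fun i => m * p.lin i, fun i j => m * p.quad i j, |m| * p.rem + r * (|p.c0| + p.varAbs + p.rem)⟩

/-- **Soundness of `sclI`.** [folklore] -/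
theorem contains_sclI {lo hi : ℚ} {p : TM q} {θ : Fin q → ℝ} (hθ : InBox θ) {x c : ℝ} (hx : p.Contains θ x)
    (hlo : (lo : ℝ) ≤ c) (hhi : c ≤ hi) : (p.sclI lo hi).Contains θ (c * x) := by
  have hsm := contains_smul ((lo + hi) / 2) hx
  have habs := p.abs_le_of_contains hθ hx
  unfold Contains at *
  have hev : (p.sclI lo hi).evalR θ = (p.smul ((lo + hi) / 2)).evalR θ := by
    simp only [sclI, smul, evalR]
  have hr1 : ((p.smul ((lo + hi) / 2)).rem : ℝ) = |(((lo + hi) / 2 : ℚ) : ℝ)| * p.rem := by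
    simp [smul]
  have hr2 : ((p.sclI lo hi).rem : ℝ) = |(((lo + hi) / 2 : ℚ) : ℝ)| * p.rem +
      (((hi - lo) / 2 : ℚ) : ℝ) * (|(p.c0 : ℝ)| + p.varAbs + p.rem) := by
    simp [sclI]
  rw [hev, hr2, evalR_smul]
  rw [hr1, evalR_smul] at hsm
  have hc : |c - (((lo + hi) / 2 : ℚ) : ℝ)| ≤ (((hi - lo) / 2 : ℚ) : ℝ) := by
    push_cast; rw [abs_le]; constructor <;> linarith
  have e : c * x - ((((lo + hi) / 2 : ℚ) : ℝ)) * p.evalR θ =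
      ((((lo + hi) / 2 : ℚ) : ℝ) * x - (((lo + hi) / 2 : ℚ) : ℝ) * p.evalR θ) + (c - (((lo + hi) / 2 : ℚ) : ℝ)) * x := by
    ring
  rw [e]
  refine (abs_add_le _ _).trans (add_le_add hsm ?_)
  rw [abs_mul]
  exact mul_le_mul hc habs (abs_nonneg _) ((abs_nonneg _).trans hc)

/-! ### The truncated square -/

/-- Square of a Taylor model: polynomial part as in `mul p p`, the remainder cross term re-centred. [folklore] -/
def sq (p : TM q) : TM q :=
  ⟨p.c0 * p.c0 + p.rem * p.rem / 2,
   fun i => p.c0 * p.lin i + p.c0 * p.lin i,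
   fun i j => p.c0 * p.quad i j + p.c0 * p.quad i j +
     (if i = j then p.lin i * p.lin i else p.lin i * p.lin j + p.lin j * p.lin i),
   p.linAbs * p.quadAbs + p.quadAbs * p.linAbs + p.quadAbs * p.quadAbs +
     (p.rem + p.rem) * (|p.c0| + p.varAbs) + p.rem * p.rem / 2⟩

/-- `sq p` evaluates to `(mul p p)(θ) + ρ²/2`. [folklore] -/
theorem evalR_sq (p : TM q) (θ : Fin q → ℝ) :
    (p.sq).evalR θ = (p.mul p).evalR θ + (p.rem : ℝ) * p.rem / 2 := by
  simp only [evalR, sq, mul]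
  push_cast
  ring

/-- **Soundness of `sq`**: if `p` contains `x` at a box point, `sq p` contains `x²`. [folklore] -/
theorem contains_sq {p : TM q} {θ : Fin q → ℝ} (hθ : InBox θ) {x : ℝ} (hx : p.Contains θ x) :
    (p.sq).Contains θ (x * x) := by
  unfold Contains at *
  set Lp : ℝ := ∑ i, (p.lin i : ℝ) * θ i with hLp
  set Qp : ℝ := ∑ i, ∑ j, if i ≤ j then (p.quad i j : ℝ) * θ i * θ j else 0 with hQp
  have hP : p.evalR θ = (p.c0 : ℝ) + Lp + Qp := rfl
  have hM : (p.mul p).evalR θ = (p.c0 : ℝ) * p.c0 + p.c0 * Lp + p.c0 * Lp + p.c0 * Qp + p.c0 * Qp + Lp * Lp := by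
    rw [evalR_mul]
  have aLp : |Lp| ≤ p.linAbs := p.abs_lin_le hθ
  have aQp : |Qp| ≤ p.quadAbs := p.abs_quad_le hθ
  set e : ℝ := x - p.evalR θ with he
  have hxe : x = (p.c0 : ℝ) + Lp + Qp + e := by rw [he, hP]; ring
  have hrem : ((p.sq).rem : ℝ) = p.linAbs * p.quadAbs + p.quadAbs * p.linAbs + p.quadAbs * p.quadAbs +
      (p.rem + p.rem) * (|(p.c0 : ℝ)| + p.varAbs) + p.rem * p.rem / 2 := by
    simp [sq]
  rw [evalR_sq, hM, hrem]
  have hva : ((p.varAbs : ℚ) : ℝ) = p.linAbs + p.quadAbs := by unfold varAbs; push_cast; ring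
  have hPv : |(p.c0 : ℝ) + Lp + Qp| ≤ |(p.c0 : ℝ)| + p.varAbs := by
    rw [hva]
    refine ((abs_add_le _ _).trans (add_le_add (abs_add_le _ _) le_rfl)).trans ?_
    linarith
  have key : x * x - ((p.c0 : ℝ) * p.c0 + p.c0 * Lp + p.c0 * Lp + p.c0 * Qp + p.c0 * Qp + Lp * Lp + (p.rem : ℝ) * p.rem / 2)
      = (Lp * Qp + Qp * Lp + Qp * Qp) + (e + e) * ((p.c0 : ℝ) + Lp + Qp) + (e * e - (p.rem : ℝ) * p.rem / 2) := by
    rw [hxe]; ring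
  rw [key]
  have t1 : |Lp * Qp| ≤ p.linAbs * p.quadAbs := by
    rw [abs_mul]; exact mul_le_mul aLp aQp (abs_nonneg _) ((abs_nonneg _).trans aLp)
  have t2 : |Qp * Lp| ≤ p.quadAbs * p.linAbs := by
    rw [abs_mul]; exact mul_le_mul aQp aLp (abs_nonneg _) ((abs_nonneg _).trans aQp)
  have t3 : |Qp * Qp| ≤ p.quadAbs * p.quadAbs := by
    rw [abs_mul]; exact mul_le_mul aQp aQp (abs_nonneg _) ((abs_nonneg _).trans aQp)
  have t4 : |(e + e) * ((p.c0 : ℝ) + Lp + Qp)| ≤ (p.rem + p.rem) * (|(p.c0 : ℝ)| + p.varAbs) := by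
    rw [abs_mul]
    refine mul_le_mul ((abs_add_le _ _).trans (add_le_add hx hx)) hPv (abs_nonneg _) ?_
    have : (0 : ℝ) ≤ p.rem := (abs_nonneg _).trans hx
    linarith
  have t5 : |e * e - (p.rem : ℝ) * p.rem / 2| ≤ (p.rem : ℝ) * p.rem / 2 := by
    have h0 : 0 ≤ e * e := mul_self_nonneg e
    have h1 : e * e ≤ (p.rem : ℝ) * p.rem := by
      have := hx
      have hr : (0:ℝ) ≤ p.rem := (abs_nonneg _).trans hx
      calc e * e = |e| * |e| := (abs_mul_abs_self e).symm
        _ ≤ p.rem * p.rem := mul_le_mul hx hx (abs_nonneg _) hr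
    rw [abs_le]; constructor <;> linarith
  calc |Lp * Qp + Qp * Lp + Qp * Qp + (e + e) * ((p.c0 : ℝ) + Lp + Qp) + (e * e - (p.rem : ℝ) * p.rem / 2)|
      ≤ |Lp * Qp| + |Qp * Lp| + |Qp * Qp| + |(e + e) * ((p.c0 : ℝ) + Lp + Qp)| + |e * e - (p.rem : ℝ) * p.rem / 2| := by
        refine (abs_add_le _ _).trans (add_le_add ((abs_add_le _ _).trans (add_le_add ((abs_add_le _ _).trans
          (add_le_add (abs_add_le _ _) le_rfl)) le_rfl)) le_rfl)
    _ ≤ _ := by linarith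

/-! ### One-sided range bounds -/

/-- Sum of `|Q_{ij}|` over the off-diagonal used entries `i < j`. [folklore] -/
def offAbs (p : TM q) : ℚ := ∑ i, ∑ j, if i < j then |p.quad i j| else 0

/-- Sum of the positive parts of the diagonal coefficients. [folklore] -/
def diagPos (p : TM q) : ℚ := ∑ i, max (p.quad i i) 0

/-- Sum of the negative parts of the diagonal coefficients. [folklore] -/
def diagNeg (p : TM q) : ℚ := ∑ i, min (p.quad i i) 0

/-- One-sided upper range bound (`Q_{ii}θᵢ² ≤ max(Q_{ii},0)`). [folklore] -/
def hi2 (p : TM q) : ℚ := p.c0 + p.linAbs + p.offAbs + p.diagPos + p.rem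

/-- One-sided lower range bound (`Q_{ii}θᵢ² ≥ min(Q_{ii},0)`). [folklore] -/
def lo2 (p : TM q) : ℚ := p.c0 - p.linAbs - p.offAbs + p.diagNeg - p.rem

/-- `θᵢ θⱼ`-weighted coefficient versus its one-sided bound, entrywise (upper). [folklore] -/
theorem quad_entry_le (p : TM q) {θ : Fin q → ℝ} (hθ : InBox θ) (i j : Fin q) :
    (if i ≤ j then (p.quad i j : ℝ) * θ i * θ j else 0) ≤
      (if i < j then |(p.quad i j : ℝ)| else 0) + (if i = j then max (p.quad i i : ℝ) 0 else 0) := by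
  have hi := hθ i; have hj := hθ j
  have hprod : |θ i| * |θ j| ≤ 1 := by nlinarith [abs_nonneg (θ i), abs_nonneg (θ j)]
  by_cases hij : i = j
  · subst hij
    simp only [le_refl, if_true, lt_irrefl, if_false, zero_add]
    have h0 : 0 ≤ θ i * θ i := mul_self_nonneg _
    have h1 : θ i * θ i ≤ 1 := by rw [← abs_mul_abs_self]; exact hprod
    rcases le_or_gt 0 (p.quad i i : ℝ) with hq | hq
    · calc (p.quad i i : ℝ) * θ i * θ i = (p.quad i i : ℝ) * (θ i * θ i) := by ring
        _ ≤ (p.quad i i : ℝ) * 1 := mul_le_mul_of_nonneg_left h1 hq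
        _ ≤ max (p.quad i i : ℝ) 0 := by rw [mul_one]; exact le_max_left _ _
    · calc (p.quad i i : ℝ) * θ i * θ i = (p.quad i i : ℝ) * (θ i * θ i) := by ring
        _ ≤ 0 := mul_nonpos_of_nonpos_of_nonneg hq.le h0
        _ ≤ max (p.quad i i : ℝ) 0 := le_max_right _ _
  · by_cases hle : i ≤ j
    · have hlt : i < j := lt_of_le_of_ne hle hij
      simp only [if_pos hle, if_pos hlt, if_neg hij, add_zero]
      calc (p.quad i j : ℝ) * θ i * θ j ≤ |(p.quad i j : ℝ) * θ i * θ j| := le_abs_self _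
        _ = |(p.quad i j : ℝ)| * (|θ i| * |θ j|) := by rw [abs_mul, abs_mul]; ring
        _ ≤ |(p.quad i j : ℝ)| * 1 := mul_le_mul_of_nonneg_left hprod (abs_nonneg _)
        _ = |(p.quad i j : ℝ)| := mul_one _
    · have hnl : ¬ i < j := fun h => hle h.le
      simp only [if_neg hle, if_neg hnl, if_neg hij, add_zero, le_refl]

/-- Entrywise lower bound. [folklore] -/
theorem le_quad_entry (p : TM q) {θ : Fin q → ℝ} (hθ : InBox θ) (i j : Fin q) :
    -(if i < j then |(p.quad i j : ℝ)| else 0) + (if i = j then min (p.quad i i : ℝ) 0 else 0) ≤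
      (if i ≤ j then (p.quad i j : ℝ) * θ i * θ j else 0) := by
  have hi := hθ i; have hj := hθ j
  have hprod : |θ i| * |θ j| ≤ 1 := by nlinarith [abs_nonneg (θ i), abs_nonneg (θ j)]
  by_cases hij : i = j
  · subst hij
    simp only [le_refl, if_true, lt_irrefl, if_false, neg_zero, zero_add]
    have h0 : 0 ≤ θ i * θ i := mul_self_nonneg _
    have h1 : θ i * θ i ≤ 1 := by rw [← abs_mul_abs_self]; exact hprod
    rcases le_or_gt 0 (p.quad i i : ℝ) with hq | hq
    · calc min (p.quad i i : ℝ) 0 ≤ 0 := min_le_right _ _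
        _ ≤ (p.quad i i : ℝ) * (θ i * θ i) := mul_nonneg hq h0
        _ = (p.quad i i : ℝ) * θ i * θ i := by ring
    · calc min (p.quad i i : ℝ) 0 ≤ (p.quad i i : ℝ) := min_le_left _ _
        _ = (p.quad i i : ℝ) * 1 := (mul_one _).symm
        _ ≤ (p.quad i i : ℝ) * (θ i * θ i) := mul_le_mul_of_nonpos_left h1 hq.le
        _ = (p.quad i i : ℝ) * θ i * θ i := by ring
  · by_cases hle : i ≤ j
    · have hlt : i < j := lt_of_le_of_ne hle hij
      simp only [if_pos hle, if_pos hlt, if_neg hij, add_zero]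
      calc -|(p.quad i j : ℝ)| = -(|(p.quad i j : ℝ)| * 1) := by rw [mul_one]
        _ ≤ -(|(p.quad i j : ℝ)| * (|θ i| * |θ j|)) :=
          neg_le_neg (mul_le_mul_of_nonneg_left hprod (abs_nonneg _))
        _ = -|(p.quad i j : ℝ) * θ i * θ j| := by rw [abs_mul, abs_mul]; ring
        _ ≤ (p.quad i j : ℝ) * θ i * θ j := neg_abs_le _
    · have hnl : ¬ i < j := fun h => hle h.le
      simp only [if_neg hle, if_neg hnl, if_neg hij, add_zero, neg_zero, le_refl]

/-- The quadratic part is at most `offAbs + diagPos` on the box. [folklore] -/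
theorem quad_le_offAbs_add_diagPos (p : TM q) {θ : Fin q → ℝ} (hθ : InBox θ) :
    (∑ i, ∑ j, if i ≤ j then (p.quad i j : ℝ) * θ i * θ j else 0) ≤ ((p.offAbs + p.diagPos : ℚ) : ℝ) := by
  have hsum : (∑ i, ∑ j, if i ≤ j then (p.quad i j : ℝ) * θ i * θ j else 0) ≤
      ∑ i, ∑ j, ((if i < j then |(p.quad i j : ℝ)| else 0) + (if i = j then max (p.quad i i : ℝ) 0 else 0)) :=
    Finset.sum_le_sum fun i _ => Finset.sum_le_sum fun j _ => p.quad_entry_le hθ i j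
  refine hsum.trans (le_of_eq ?_)
  simp only [Finset.sum_add_distrib, Finset.sum_ite_eq, Finset.mem_univ, if_true, offAbs, diagPos]
  push_cast
  congr 1
  refine Finset.sum_congr rfl fun i _ => Finset.sum_congr rfl fun j _ => ?_
  split_ifs <;> simp

/-- The quadratic part is at least `-offAbs + diagNeg` on the box. [folklore] -/
theorem neg_offAbs_add_diagNeg_le_quad (p : TM q) {θ : Fin q → ℝ} (hθ : InBox θ) :
    ((-p.offAbs + p.diagNeg : ℚ) : ℝ) ≤ (∑ i, ∑ j, if i ≤ j then (p.quad i j : ℝ) * θ i * θ j else 0) := by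
  have hsum : (∑ i, ∑ j, (-(if i < j then |(p.quad i j : ℝ)| else 0) + (if i = j then min (p.quad i i : ℝ) 0 else 0)))
      ≤ ∑ i, ∑ j, if i ≤ j then (p.quad i j : ℝ) * θ i * θ j else 0 :=
    Finset.sum_le_sum fun i _ => Finset.sum_le_sum fun j _ => p.le_quad_entry hθ i j
  refine le_trans (le_of_eq ?_) hsum
  simp only [Finset.sum_add_distrib, Finset.sum_neg_distrib, Finset.sum_ite_eq, Finset.mem_univ, if_true,
    offAbs, diagNeg]
  push_cast
  congr 1
  congr 1
  refine Finset.sum_congr rfl fun i _ => Finset.sum_congr rfl fun j _ => ?_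
  split_ifs <;> simp

/-- **One-sided range soundness (upper).** [folklore] -/
theorem le_hi2 (p : TM q) {θ : Fin q → ℝ} (hθ : InBox θ) {x : ℝ} (hx : p.Contains θ x) : x ≤ (p.hi2 : ℝ) := by
  unfold hi2; unfold Contains at hx
  have h1 := p.abs_lin_le hθ
  have h2 := p.quad_le_offAbs_add_diagPos hθ
  have hev : p.evalR θ = (p.c0 : ℝ) + (∑ i, (p.lin i : ℝ) * θ i) +
      ∑ i, ∑ j, if i ≤ j then (p.quad i j : ℝ) * θ i * θ j else 0 := rfl
  push_cast at h2 ⊢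
  have := (abs_le.mp hx).2; have := (abs_le.mp h1).2
  linarith

/-- **One-sided range soundness (lower).** [folklore] -/
theorem lo2_le (p : TM q) {θ : Fin q → ℝ} (hθ : InBox θ) {x : ℝ} (hx : p.Contains θ x) : (p.lo2 : ℝ) ≤ x := by
  unfold lo2; unfold Contains at hx
  have h1 := p.abs_lin_le hθ
  have h2 := p.neg_offAbs_add_diagNeg_le_quad hθ
  have hev : p.evalR θ = (p.c0 : ℝ) + (∑ i, (p.lin i : ℝ) * θ i) +
      ∑ i, ∑ j, if i ≤ j then (p.quad i j : ℝ) * θ i * θ j else 0 := rfl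
  push_cast at h2 ⊢
  have := (abs_le.mp hx).1; have := (abs_le.mp h1).1
  linarith

end TM

end Summit.NavierStokesRegularity.NavierStokesRegularity.Cruxes.RelayFrontStep.PhaseI
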